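/-
Copyright: statement-level skeleton of a published paper (lit-balaban cell, Phase-2 proof seat p25, gen 18). No proof
claims beyond what the kernel checks below.
-/
import Literature.MathematicalPhysics.QuantumFieldTheory.BalabanImbrieJaffe1984to88.BIJ88WalkExpansion311
import Literature.MathematicalPhysics.QuantumFieldTheory.BalabanImbrieJaffe1984to88.BIJ88Resummation312

/-!
# `BalabanImbrieJaffe1984to88.BIJ88WalkIdentity311` — T. Bałaban, J. Imbrie, A. Jaffe, *Effective action and
cluster properties of the abelian Higgs model*, Commun. Math. Phys. **114** (1988) 257–315 [BalabanImbrieJaffe1988],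
§5.14 p. 311–312 [PDF 55–56] *"We integrate by parts in the Gaussian expectation (5.14.1). … After each integration
by parts, we replace the covariance by C_loc … and give a random walk expansion for the difference. … Summing all
terms in X_r gives an observable F_{k,rem}(X_r). Then the result of the integration by parts is …"* — **THE COMPONENT
EXPANSION WITH THE COVARIANCE SPLIT LOSES NOTHING** (p25 gen 18): when the pieces add up to the covariance,
`Σ_p Cov p = A⁻¹`, one integration by parts splits over the pieces (`gintM_cons_split`: each of the four printed
alternatives — another leg, the source, `χ′`, the interaction — through each piece, the `χ′`-direction splitting by
linearity of the derivative), the run of one component loses nothing (`run_val`) and so does the whole expansion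
(`expand_val`, `expand_val_init`): the Gaussian integral of the product of all observables' legs against `χe^{−V}dμ_{C,ℱ}`
equals the sum over the terms of coefficient × the integral of the remainder components' pending legs against
`(Π_{dirs}∂)χ · e^{−V}`.  The gen-16 identity `BIJ88LabelledExpansion311.expand_val` re-proved for the run with pieces and
the random-walk trigger.

statement-level skeleton of published theorems with citation tags; proofs where landed; nothing here is a claim
about the Yang–Mills mass gap

PDF held: `paper:balaban1988-cmp114-bij-abelian-higgs-effective-action` (journal page = PDF page + 256); p. 311–312 =
PDF 55–56 (`p0055.txt` L23–38, `p0056.txt` L1–9 re-read this session, 2026-08-22).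

CITATION HEADER (lean-in-tree rule).  lit-balaban cell (HOME `run/shared/lean/pub/lit-balaban/`), Phase 2, seat p25
gen 18; row **C2.Claim@312** of `HOME/lit-balaban-r16/ROWS-C2-part2.md` (owner r16, referee ref-5; head
`BIJ88Sect5StatementsPart4.Ineq312` untouched).  USED BY NAME, nothing restated: `BIJ88WalkRun311.{WGrp, WOut, run,
pristine, rpot, …}`, `BIJ88WalkRunEnv311.{run_rest_subset, run_done_le, run_complete, run_const}`,
`BIJ88WalkExpansion311.{WTerm, oact, expand, …}` (this seat and generation); `BIJ88LabelledExpansion311.{gintM,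
gintM_coe, gintM_cons, sum_range_eraseIdx_eq, sum_map_carriers}`, `BIJ88LabelledRun311.{sum_map_bind, sum_map_fbind,
sum_map_mbind}`, `BIJ88Resummation312.sum_map_finset_sum_comm` (p25 gen 16), `BIJ88VertexComponentsExpansion311.gint`, `BIJ88VertexIbp311.{lmono, vexp,
integrable_lmono, continuous_vexp}` (p25 gen 15), `BIJ88WickDerivatives305.dlist` (p25 gen 14),
`B2Eq228Conditioning.{weight, source}`.

## What is proved (0 `sorry`, standard axioms, no new `Prop` facts; definitions with bodies: `legsOf`, `oval`, `tval`)

* §1 `dlist_append_singleton'`, `gint_dir_sum` / **`gintM_dir_sum`** (the `χ′` term is linear in the direction: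
  `∫Π_PΦ·(Π_D∂)∂_{Σ_p z_p}χe^{−V} = Σ_p ∫Π_PΦ·(Π_D∂)∂_{z_p}χe^{−V}`), **`gintM_cons_split`** (ONE
  INTEGRATION BY PARTS THROUGH THE PIECES: given `Σ_p Cov p = A⁻¹`, the head leg pairs with another leg / goes to the
  source / to `χ′` / differentiates down a vertex, through each piece `p` with the bracket of `Cov p`).
* §2 `legsOf` (+ `legsOf_erase`, `legsOf_erase_done`, `legsOf_cons`), `oval` (+ `sum_oval_scale`, `sum_oval_bump`,
  `sum_oval_push`), **`run_val`** (the run of one component loses nothing), `tval` (+ `tval_act`, `tval_addConst`),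
  **`expand_val`**, **`expand_val_init`**.
HONEST SCOPE: (a) the analytic hypotheses are gen 15's (`A` positive definite, every `(Π∂)χ` of class `C¹` with
`(Π∂)χ·e^{−V}` bounded) plus the ALGEBRAIC datum `Σ_p Cov p = A⁻¹` — print's `C_loc` and the random-walk expansion of
`C − C_loc` are not constructed (refs. 3–5 of the paper); (b) contraction-graph components, fixed order of events;
(c) no estimates.  NOT summit progress; NOT continuum; NOT Clay.  Imports `BIJ88WalkExpansion311`,
`BIJ88Resummation312` (for `BIJ88LabelledExpansion311` and a generic sum lemma); modifies nothing.
-/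

noncomputable section

namespace Literature.MathematicalPhysics.QuantumFieldTheory.BalabanImbrieJaffe1984to88.BIJ88WalkIdentity311

open Classical MeasureTheory Matrix Finset
open scoped BigOperators
open Literature.MathematicalPhysics.QuantumFieldTheory.Balaban1983to89
open B2Eq228Conditioning (weight source)
open BIJ88VertexIbp311 (lmono vexp integrable_lmono continuous_vexp)
open BIJ88WickDerivatives305 (dlist dlist_cons)
open BIJ88VertexComponents311 (maxArity)
open BIJ88VertexComponentsExpansion311 (gint)
open BIJ88LabelledRun311 (fbind mbind sum_map_bind sum_map_fbind sum_map_mbind)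
open BIJ88LabelledExpansion311 (gintM gintM_coe gintM_cons sum_range_eraseIdx_eq sum_map_carriers)
open BIJ88Resummation312 (sum_map_finset_sum_comm)
open BIJ88WalkRun311 BIJ88WalkRunEnv311 BIJ88WalkExpansion311

variable {S : Type} [Fintype S] {ι : Type} [Fintype ι] {κ : Type} [LinearOrder κ] {P : Type} [Fintype P]

/-! ## §1  One integration by parts through the pieces -/

section Split

variable (A : Matrix S S ℝ) (f : S → ℝ) (c : ι → ℝ) (legs : ι → List (S → ℝ)) (χ : (S → ℝ) → ℝ)

omit [Fintype S] [LinearOrder κ] [Fintype P] in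
/-- One more derivative at the end of the list: `dlist (D ++ [z]) H = ∂_z (dlist D H)`. [folklore] -/
private theorem dlist_append_singleton' : ∀ (D : List (S → ℝ)) (H : (S → ℝ) → ℝ) (z : S → ℝ),
    dlist (D ++ [z]) H = fun φ => fderiv ℝ (dlist D H) φ z
  | [], _, _ => rfl
  | a :: D, H, z => by
    rw [List.cons_append, dlist_cons, dlist_cons, dlist_append_singleton' D _ z]

omit [LinearOrder κ] in
/-- **The `χ′` term is linear in the direction** (list form): `gint R (D ++ [Σ_p z_p]) = Σ_p gint R (D ++ [z_p])`, by
linearity of the Fréchet derivative and additivity of the integral (each summand integrable: a monomial times the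
bounded continuous `(Π_D∂)∂_{z_p}χ · e^{−V}`). [cite: BalabanImbrieJaffe1988, §5.14 p.311] -/
theorem gint_dir_sum (hA : A.PosDef) (hχ : ∀ D : List (S → ℝ), ContDiff ℝ 1 (dlist D χ))
    (h0 : ∀ D : List (S → ℝ), ∃ K, ∀ φ, ‖dlist D χ φ * vexp c legs φ‖ ≤ K) (R D : List (S → ℝ)) (z : P → S → ℝ) :
    gint A f χ c legs R (D ++ [∑ p, z p]) = ∑ p, gint A f χ c legs R (D ++ [z p]) := by
  simp only [gint, dlist_append_singleton', map_sum, Finset.sum_mul, Finset.mul_sum]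
  rw [integral_finsetSum _ fun p _ => ?_]
  have hc : Continuous fun φ : S → ℝ => fderiv ℝ (dlist D χ) φ (z p) * vexp c legs φ :=
    (((hχ D).continuous_fderiv one_ne_zero).clm_apply continuous_const).mul (continuous_vexp c legs)
  obtain ⟨K, hK⟩ := h0 (D ++ [z p])
  have hK' : ∀ φ, ‖fderiv ℝ (dlist D χ) φ (z p) * vexp c legs φ‖ ≤ K := fun φ => by
    have h := hK φ
    rwa [dlist_append_singleton'] at h
  exact integrable_lmono hA f hc hK' R

omit [LinearOrder κ] in
/-- **The `χ′` term is linear in the direction** (multiset form). [cite: BalabanImbrieJaffe1988, §5.14 p.311] -/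
theorem gintM_dir_sum (hA : A.PosDef) (hχ : ∀ D : List (S → ℝ), ContDiff ℝ 1 (dlist D χ))
    (h0 : ∀ D : List (S → ℝ), ∃ K, ∀ φ, ‖dlist D χ φ * vexp c legs φ‖ ≤ K) (Q : Multiset (S → ℝ)) (D : List (S → ℝ))
    (z : P → S → ℝ) :
    gintM A f c legs χ Q (D ++ [∑ p, z p]) = ∑ p, gintM A f c legs χ Q (D ++ [z p]) := by
  induction Q using Quot.ind with
  | mk R =>
    simp only [Multiset.quot_mk_to_coe'', gintM_coe]
    exact gint_dir_sum A f c legs χ hA hχ h0 R D z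

omit [LinearOrder κ] in
/-- **ONE INTEGRATION BY PARTS THROUGH THE PIECES** (p. 311 *"After each integration by parts, we replace the
covariance by C_loc … and give a random walk expansion for the difference"*): when `Σ_p Cov p = A⁻¹`, the head leg
`Φ(u)` pairs with any other leg (weight `⟨Cov p u, w⟩`), goes to the source (`⟨Cov p u, ℱ⟩`), to `χ′` (one more
direction `Cov p u`), or differentiates down the vertex `m` through its leg `j` (weight `−c_m⟨Cov p u, w_{m,j}⟩`, the
other legs join) — summed over the pieces `p`. [cite: BalabanImbrieJaffe1988, §5.14 p.311] -/
theorem gintM_cons_split (Cov : P → Matrix S S ℝ) (hA : A.PosDef) (hχ : ∀ D : List (S → ℝ), ContDiff ℝ 1 (dlist D χ))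
    (h0 : ∀ D : List (S → ℝ), ∃ K, ∀ φ, ‖dlist D χ φ * vexp c legs φ‖ ≤ K) (hCov : ∑ p, Cov p = A⁻¹) (u : S → ℝ)
    (Q : Multiset (S → ℝ)) (D : List (S → ℝ)) :
    gintM A f c legs χ (u ::ₘ Q) D
      = ∑ p, ((Q.map fun w => ((Cov p *ᵥ u) ⬝ᵥ w) * gintM A f c legs χ (Q.erase w) D).sum
          + ((Cov p *ᵥ u) ⬝ᵥ f) * gintM A f c legs χ Q D
          + gintM A f c legs χ Q (D ++ [Cov p *ᵥ u])
          + ∑ m, ∑ j ∈ range (legs m).length, (-(c m * ((Cov p *ᵥ u) ⬝ᵥ (legs m).getD j 0))) *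
              gintM A f c legs χ (Q + ((legs m).eraseIdx j : List (S → ℝ))) D) := by
  have hu : A⁻¹ *ᵥ u = ∑ p, Cov p *ᵥ u := by rw [← hCov, Matrix.sum_mulVec]
  rw [gintM_cons A f c legs χ hA hχ h0 u Q D, hu, gintM_dir_sum A f c legs χ hA hχ h0 Q D]
  simp only [sum_dotProduct, Finset.sum_mul, sum_map_finset_sum_comm, Finset.sum_add_distrib]
  congr 1
  -- the vertex sums: move the sum over the pieces outside
  rw [Finset.sum_comm]
  refine Finset.sum_congr rfl fun m _ => ?_
  rw [Finset.sum_comm]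
  refine Finset.sum_congr rfl fun j _ => ?_
  rw [Finset.mul_sum, ← Finset.sum_neg_distrib, Finset.sum_mul]

end Split

/-! ## §2  The identity: nothing is lost -/

variable (A : Matrix S S ℝ) (Cov : P → Matrix S S ℝ) (trig : P → Bool) (f : S → ℝ) (c : ι → ℝ)
  (legs : ι → List (S → ℝ)) (χ : (S → ℝ) → ℝ) (obs : κ → List (S → ℝ)) (M : ℕ)

/-- **All pending legs of a state**: the pending legs of the components set aside and the legs of the untouched
observables. [cite: BalabanImbrieJaffe1988, §5.14 p.311] -/
def legsOf (done : Multiset (WGrp S κ ι P)) (rest : Finset κ) : Multiset (S → ℝ) :=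
  (done.map fun h => (h.pend : Multiset (S → ℝ))).sum + (rest.val.map fun j => (obs j : Multiset (S → ℝ))).sum

omit [Fintype S] [Fintype ι] [LinearOrder κ] [Fintype P] in
/-- Taking an untouched observable out of the environment. [cite: BalabanImbrieJaffe1988, §5.14 p.311] -/
theorem legsOf_erase [DecidableEq κ] (done : Multiset (WGrp S κ ι P)) {rest : Finset κ} {j : κ} (hj : j ∈ rest) :
    legsOf obs done rest = (obs j : Multiset (S → ℝ)) + legsOf obs done (rest.erase j) := by
  unfold legsOf
  conv_lhs => rw [← Finset.insert_erase hj, Finset.insert_val_of_notMem (Finset.notMem_erase j rest)]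
  rw [Multiset.map_cons, Multiset.sum_cons]
  abel

omit [Fintype S] [Fintype ι] [LinearOrder κ] [Fintype P] in
/-- Taking a set-aside component out. [cite: BalabanImbrieJaffe1988, §5.14 p.311] -/
theorem legsOf_erase_done [DecidableEq κ] {done : Multiset (WGrp S κ ι P)} (rest : Finset κ) {h : WGrp S κ ι P}
    (hh : h ∈ done) :
    legsOf obs done rest = (h.pend : Multiset (S → ℝ)) + legsOf obs (done.erase h) rest := by
  unfold legsOf
  conv_lhs => rw [← Multiset.cons_erase hh]
  rw [Multiset.map_cons, Multiset.sum_cons, add_assoc]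

omit [Fintype S] [Fintype ι] [LinearOrder κ] [Fintype P] in
/-- Setting a component aside. [cite: BalabanImbrieJaffe1988, §5.14 p.311] -/
theorem legsOf_cons (done : Multiset (WGrp S κ ι P)) (rest : Finset κ) (g : WGrp S κ ι P) :
    legsOf obs (g ::ₘ done) rest = (g.pend : Multiset (S → ℝ)) + legsOf obs done rest := by
  unfold legsOf
  rw [Multiset.map_cons, Multiset.sum_cons, add_assoc]

/-- **The value of an outcome** given the `χ′`-directions `D` already present: its weight times the Gaussian integral
of all pending legs left against `(Π_{z ∈ D ++ D_o}∂_z)χ · e^{−V}`. [cite: BalabanImbrieJaffe1988, §5.14 p.311–312] -/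
def oval (D : List (S → ℝ)) (o : WOut S κ ι P) : ℝ :=
  o.a * gintM A f c legs χ ((o.g.pend : Multiset (S → ℝ)) + legsOf obs o.done o.rest) (D ++ o.D)

omit [LinearOrder κ] [Fintype P] in
/-- Values of scaled outcomes (bookkeeping). [cite: BalabanImbrieJaffe1988, §5.14 p.311] -/
theorem sum_oval_scale (D : List (S → ℝ)) (p : P) (w : ℝ) (X : Multiset (WOut S κ ι P)) :
    ((X.map (WOut.scale p w)).map (oval A f c legs χ obs D)).sum = w * (X.map (oval A f c legs χ obs D)).sum := by
  rw [Multiset.map_map, ← Multiset.sum_map_mul_left]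
  refine congrArg _ (Multiset.map_congr rfl fun o _ => ?_)
  simp only [oval, Function.comp_apply, WOut.scale_a, WOut.scale_g, WOut.scale_done, WOut.scale_rest, WOut.scale_D,
    mul_assoc]

omit [LinearOrder κ] [Fintype P] in
/-- Values of scaled outcomes with a vertex recorded (bookkeeping). [cite: BalabanImbrieJaffe1988, §5.14 p.311] -/
theorem sum_oval_bump (D : List (S → ℝ)) (p : P) (w : ℝ) (X : Multiset (WOut S κ ι P)) :
    ((X.map fun o => (o.scale p w).bump).map (oval A f c legs χ obs D)).sum
      = w * (X.map (oval A f c legs χ obs D)).sum := by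
  rw [Multiset.map_map, ← Multiset.sum_map_mul_left]
  refine congrArg _ (Multiset.map_congr rfl fun o _ => ?_)
  simp only [oval, Function.comp_apply, WOut.bump_a, WOut.bump_g, WOut.bump_done, WOut.bump_rest, WOut.bump_D,
    WOut.scale_a, WOut.scale_g, WOut.scale_done, WOut.scale_rest, WOut.scale_D, mul_assoc]

omit [LinearOrder κ] [Fintype P] in
/-- Values of outcomes with an earlier `χ′`-direction recorded (bookkeeping). [cite: BalabanImbrieJaffe1988, §5.14 p.311] -/
theorem sum_oval_push (D : List (S → ℝ)) (p : P) (z : S → ℝ) (X : Multiset (WOut S κ ι P)) :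
    ((X.map (WOut.push p z)).map (oval A f c legs χ obs D)).sum = (X.map (oval A f c legs χ obs (D ++ [z]))).sum := by
  rw [Multiset.map_map]
  refine congrArg _ (Multiset.map_congr rfl fun o _ => ?_)
  simp only [oval, Function.comp_apply, WOut.push_a, WOut.push_g, WOut.push_done, WOut.push_rest, WOut.push_D,
    List.append_assoc, List.singleton_append]

variable {A Cov trig f c legs χ obs M}

/-- **THE RUN OF ONE COMPONENT WITH THE COVARIANCE SPLIT LOSES NOTHING** (p. 311: the six events through the pieces
are one integration by parts each, split by `Σ_p Cov p = A⁻¹`):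
`∫ Π_{g.pend ∪ legsOf done rest}Φ · (Π_D∂)χ · e^{−V} dμ = Σ_{o ∈ run g rest done} a_o · ∫ Π_{o.g.pend ∪ legsOf o.done o.rest}Φ · (Π_{D ++ D_o}∂)χ · e^{−V} dμ`.
[cite: BalabanImbrieJaffe1988, §5.14 p.311–312] -/
theorem run_val (hA : A.PosDef) (hχ : ∀ D : List (S → ℝ), ContDiff ℝ 1 (dlist D χ))
    (h0 : ∀ D : List (S → ℝ), ∃ K, ∀ φ, ‖dlist D χ φ * vexp c legs φ‖ ≤ K) (hCov : ∑ p, Cov p = A⁻¹) :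
    ∀ (n : ℕ) (g : WGrp S κ ι P) (rest : Finset κ) (done : Multiset (WGrp S κ ι P)),
      rpot obs M (maxArity legs) g rest done < n → ∀ D : List (S → ℝ),
        gintM A f c legs χ ((g.pend : Multiset (S → ℝ)) + legsOf obs done rest) D
          = ((run Cov trig f c legs obs M g rest done).map (oval A f c legs χ obs D)).sum
  | 0, _, _, _, hn => fun _ => absurd hn (Nat.not_lt_zero _)
  | n + 1, g, rest, done, hn => by
    intro D
    have hn' : rpot obs M (maxArity legs) g rest done ≤ n := Nat.lt_succ_iff.1 hn
    have IH : ∀ g' rest' done', rpot obs M (maxArity legs) g' rest' done' < rpot obs M (maxArity legs) g rest done →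
        ∀ D' : List (S → ℝ), gintM A f c legs χ ((g'.pend : Multiset (S → ℝ)) + legsOf obs done' rest') D'
          = ((run Cov trig f c legs obs M g' rest' done').map (oval A f c legs χ obs D')).sum :=
      fun g' rest' done' hlt => run_val hA hχ h0 hCov n g' rest' done' (lt_of_lt_of_le hlt hn')
    by_cases hc : g.complete M = true
    · rw [run_of_complete Cov trig f c legs obs M hc]
      simp [oval]
    · obtain ⟨u, L, hp⟩ := List.exists_cons_of_ne_nil (WGrp.pend_ne_nil_of_not_complete hc)
      have hnv : Multiset.card g.vxs < M := WGrp.nv_lt_of_not_complete hc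
      have hcons : ((g.pend : Multiset (S → ℝ)) + legsOf obs done rest)
          = u ::ₘ ((L : Multiset (S → ℝ)) + legsOf obs done rest) := by
        rw [hp, ← Multiset.cons_coe, Multiset.cons_add]
      -- THE LEFT-HAND SIDE: one integration by parts of the head leg through the pieces; THE RIGHT-HAND SIDE: the
      -- outcomes grouped by the piece used first
      rw [hcons, gintM_cons_split A f c legs χ Cov hA hχ h0 hCov, run_of_not_complete Cov trig f c legs obs M hc hp rest done,
        sum_map_bind]
      refine Finset.sum_congr rfl fun p _ => ?_
      -- for a fixed piece `p`: the pairing sum split by carrier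
      have esplit : (((L : Multiset (S → ℝ)) + legsOf obs done rest).map fun w => ((Cov p *ᵥ u) ⬝ᵥ w) *
            gintM A f c legs χ (((L : Multiset (S → ℝ)) + legsOf obs done rest).erase w) D).sum
          = (∑ i ∈ range L.length, ((Cov p *ᵥ u) ⬝ᵥ L.getD i 0) *
              gintM A f c legs χ (((L.eraseIdx i : List (S → ℝ)) : Multiset (S → ℝ)) + legsOf obs done rest) D)
            + (done.map fun h => ∑ i ∈ range h.pend.length, ((Cov p *ᵥ u) ⬝ᵥ h.pend.getD i 0) *
              gintM A f c legs χ ((L : Multiset (S → ℝ)) + ((h.pend.eraseIdx i : List (S → ℝ)) : Multiset (S → ℝ))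
                + legsOf obs (done.erase h) rest) D).sum
            + ∑ j ∈ rest, ∑ i ∈ range (obs j).length, ((Cov p *ᵥ u) ⬝ᵥ (obs j).getD i 0) *
              gintM A f c legs χ ((L : Multiset (S → ℝ)) + (((obs j).eraseIdx i : List (S → ℝ)) : Multiset (S → ℝ))
                + legsOf obs done (rest.erase j)) D := by
        unfold legsOf
        rw [Multiset.map_add, Multiset.sum_add, Multiset.map_add, Multiset.sum_add, ← add_assoc]
        refine congrArg₂ (· + ·) (congrArg₂ (· + ·) ?_ ?_) ?_
        · -- legs of the component itself
          rw [sum_range_eraseIdx_eq 0 (fun w Q => ((Cov p *ᵥ u) ⬝ᵥ w) * gintM A f c legs χ (Q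
            + ((done.map fun h => (h.pend : Multiset (S → ℝ))).sum
              + (rest.val.map fun j => (obs j : Multiset (S → ℝ))).sum)) D) L]
          refine congrArg _ (Multiset.map_congr rfl fun w hw => ?_)
          rw [Multiset.erase_add_left_pos _ hw]
        · -- legs of the set-aside components
          have e1 : ∀ w ∈ (done.map fun h => (h.pend : Multiset (S → ℝ))).sum,
              ((L : Multiset (S → ℝ)) + ((done.map fun h => (h.pend : Multiset (S → ℝ))).sum
                + (rest.val.map fun j => (obs j : Multiset (S → ℝ))).sum)).erase w
                = (L : Multiset (S → ℝ)) + ((((done.map fun h => (h.pend : Multiset (S → ℝ))).sum).erase w)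
                  + (rest.val.map fun j => (obs j : Multiset (S → ℝ))).sum) := fun w hw => by
            rw [Multiset.erase_add_right_pos _ (Multiset.mem_add.2 (Or.inl hw)), Multiset.erase_add_left_pos _ hw]
          rw [Multiset.map_congr rfl fun w hw => by rw [e1 w hw],
            sum_map_carriers (fun h : WGrp S κ ι P => (h.pend : Multiset (S → ℝ))) done
              (fun w Q => ((Cov p *ᵥ u) ⬝ᵥ w) * gintM A f c legs χ ((L : Multiset (S → ℝ)) + (Q
                + (rest.val.map fun j => (obs j : Multiset (S → ℝ))).sum)) D)]
          refine congrArg _ (Multiset.map_congr rfl fun h _ => ?_)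
          rw [sum_range_eraseIdx_eq 0 (fun w Q => ((Cov p *ᵥ u) ⬝ᵥ w) *
            gintM A f c legs χ ((L : Multiset (S → ℝ)) + Q
              + (((done.erase h).map fun h => (h.pend : Multiset (S → ℝ))).sum
                + (rest.val.map fun j => (obs j : Multiset (S → ℝ))).sum)) D)]
          refine congrArg _ (Multiset.map_congr rfl fun w _ => ?_)
          simp only [add_assoc]
        · -- legs of the untouched observables
          have e1 : ∀ w ∈ (rest.val.map fun j => (obs j : Multiset (S → ℝ))).sum,
              ((L : Multiset (S → ℝ)) + ((done.map fun h => (h.pend : Multiset (S → ℝ))).sum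
                + (rest.val.map fun j => (obs j : Multiset (S → ℝ))).sum)).erase w
                = (L : Multiset (S → ℝ)) + ((done.map fun h => (h.pend : Multiset (S → ℝ))).sum
                  + (((rest.val.map fun j => (obs j : Multiset (S → ℝ))).sum).erase w)) := fun w hw => by
            rw [Multiset.erase_add_right_pos _ (Multiset.mem_add.2 (Or.inr hw)), Multiset.erase_add_right_pos _ hw]
          rw [Multiset.map_congr rfl fun w hw => by rw [e1 w hw],
            sum_map_carriers (fun j : κ => (obs j : Multiset (S → ℝ))) rest.val
              (fun w Q => ((Cov p *ᵥ u) ⬝ᵥ w) * gintM A f c legs χ ((L : Multiset (S → ℝ))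
                + ((done.map fun h => (h.pend : Multiset (S → ℝ))).sum + Q)) D), Finset.sum_eq_multiset_sum]
          refine congrArg _ (Multiset.map_congr rfl fun j _ => ?_)
          rw [sum_range_eraseIdx_eq 0 (fun w Q => ((Cov p *ᵥ u) ⬝ᵥ w) *
            gintM A f c legs χ ((L : Multiset (S → ℝ)) + Q
              + (((done.map fun h => (h.pend : Multiset (S → ℝ))).sum)
                + ((rest.erase j).val.map fun j => (obs j : Multiset (S → ℝ))).sum)) D)]
          refine congrArg _ (Multiset.map_congr rfl fun w _ => ?_)
          simp only [Finset.erase_val, add_assoc, add_left_comm]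
      rw [esplit]
      -- THE RIGHT-HAND SIDE for the piece `p`: the six groups of outcomes, each by the induction hypothesis
      simp only [Multiset.map_add, Multiset.sum_add, sum_map_bind, sum_map_fbind, sum_map_mbind, sum_oval_scale,
        sum_oval_bump, sum_oval_push]
      have r1 : ∀ i ∈ range L.length, ((Cov p *ᵥ u) ⬝ᵥ L.getD i 0) *
            ((run Cov trig f c legs obs M ⟨L.eraseIdx i, g.nchi, g.vxs, g.lab, p ::ₘ g.pcs, g.nw + (trig p).toNat⟩
              rest done).map (oval A f c legs χ obs D)).sum
          = ((Cov p *ᵥ u) ⬝ᵥ L.getD i 0) *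
            gintM A f c legs χ (((L.eraseIdx i : List (S → ℝ)) : Multiset (S → ℝ)) + legsOf obs done rest) D :=
        fun i _ => by rw [← IH _ _ _ (rpot_pair obs M _ rest done hp i _ _) D]
      have r2 : ∀ j ∈ rest.attach, ∑ i ∈ range (obs j).length, ((Cov p *ᵥ u) ⬝ᵥ (obs j).getD i 0) *
            ((run Cov trig f c legs obs M
                ⟨L ++ (obs j).eraseIdx i, g.nchi, g.vxs, g.lab ∪ {j.1}, p ::ₘ g.pcs, g.nw + (trig p).toNat⟩
                (rest.erase j) done).map (oval A f c legs χ obs D)).sum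
          = ∑ i ∈ range (obs j).length, ((Cov p *ᵥ u) ⬝ᵥ (obs j).getD i 0) *
            gintM A f c legs χ ((L : Multiset (S → ℝ)) + (((obs j).eraseIdx i : List (S → ℝ)) : Multiset (S → ℝ))
              + legsOf obs done (rest.erase j)) D :=
        fun j _ => Finset.sum_congr rfl fun i _ => by
          rw [← IH _ _ _ (rpot_pristine obs M _ rest done hp j.2 i (g.lab ∪ {j.1}) _ _) D, Multiset.coe_add]
      have r3 : ∀ h ∈ done.attach, ∑ i ∈ range h.1.pend.length, ((Cov p *ᵥ u) ⬝ᵥ h.1.pend.getD i 0) *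
            ((run Cov trig f c legs obs M (WGrp.absorb trig L g h.1 i p) rest (done.erase h.1)).map
              (oval A f c legs χ obs D)).sum
          = ∑ i ∈ range h.1.pend.length, ((Cov p *ᵥ u) ⬝ᵥ h.1.pend.getD i 0) *
            gintM A f c legs χ ((L : Multiset (S → ℝ)) + ((h.1.pend.eraseIdx i : List (S → ℝ)) : Multiset (S → ℝ))
              + legsOf obs (done.erase h.1) rest) D :=
        fun h _ => Finset.sum_congr rfl fun i _ => by
          rw [← IH _ _ _ (rpot_absorb obs M _ rest done trig hp h.2 i p) D, Multiset.coe_add]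
          rfl
      have r4 : ((Cov p *ᵥ u) ⬝ᵥ f) *
            ((run Cov trig f c legs obs M ⟨L, g.nchi, g.vxs, g.lab, p ::ₘ g.pcs, g.nw + (trig p).toNat⟩ rest done).map
              (oval A f c legs χ obs D)).sum
          = ((Cov p *ᵥ u) ⬝ᵥ f) * gintM A f c legs χ ((L : Multiset (S → ℝ)) + legsOf obs done rest) D := by
        rw [← IH _ _ _ (rpot_drop obs M _ rest done hp _ _ _) D]
      have r5 : ((run Cov trig f c legs obs M ⟨L, g.nchi + 1, g.vxs, g.lab, p ::ₘ g.pcs, g.nw + (trig p).toNat⟩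
              rest done).map (oval A f c legs χ obs (D ++ [Cov p *ᵥ u]))).sum
          = gintM A f c legs χ ((L : Multiset (S → ℝ)) + legsOf obs done rest) (D ++ [Cov p *ᵥ u]) := by
        rw [← IH _ _ _ (rpot_drop obs M _ rest done hp _ _ _) (D ++ [Cov p *ᵥ u])]
      have r6 : ∀ m ∈ (univ : Finset ι), ∀ j ∈ range (legs m).length, (-(c m * ((Cov p *ᵥ u) ⬝ᵥ (legs m).getD j 0))) *
            ((run Cov trig f c legs obs M
                ⟨L ++ (legs m).eraseIdx j, g.nchi, m ::ₘ g.vxs, g.lab, p ::ₘ g.pcs, g.nw + (trig p).toNat⟩ rest done).map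
              (oval A f c legs χ obs D)).sum
          = (-(c m * ((Cov p *ᵥ u) ⬝ᵥ (legs m).getD j 0))) *
            gintM A f c legs χ ((L : Multiset (S → ℝ)) + legsOf obs done rest
              + (((legs m).eraseIdx j : List (S → ℝ)) : Multiset (S → ℝ))) D :=
        fun m _ j _ => by
          rw [← IH _ _ _ (rpot_vertex obs M rest done legs hp hnv m j _ _) D]
          congr 2
          change (((L ++ (legs m).eraseIdx j : List (S → ℝ)) : Multiset (S → ℝ))) + _ = _
          rw [← Multiset.coe_add]
          abel
      rw [Finset.sum_congr rfl r1, Finset.sum_congr rfl r2, r4, r5,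
        Finset.sum_congr rfl fun m hm => Finset.sum_congr rfl (r6 m hm), Multiset.map_congr rfl r3,
        ← Multiset.attach_map_val' done, ← Finset.sum_attach rest]
      ring

/-- **The value of a term**: its coefficient times the Gaussian integral of its set-aside components' pending legs
against `(Π_{z ∈ D ++ dirs}∂_z)χ · e^{−V}` (blocks have no legs). [cite: BalabanImbrieJaffe1988, §5.14 p.311–312] -/
def tval (A : Matrix S S ℝ) (f : S → ℝ) (c : ι → ℝ) (legs : ι → List (S → ℝ)) (χ : (S → ℝ) → ℝ)
    (D : List (S → ℝ)) (t : WTerm S κ ι P) : ℝ :=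
  t.coef * gintM A f c legs χ ((t.groups.map fun h => (h.pend : Multiset (S → ℝ))).sum) (D ++ t.dirs)

omit [LinearOrder κ] [Fintype P] in
/-- How an outcome acts on values: `tval D (oact o t) = a_o · tval (D ++ D_o) t`, blocks being invisible.
[cite: BalabanImbrieJaffe1988, §5.14 p.311] -/
theorem tval_act (D : List (S → ℝ)) (o : WOut S κ ι P) (t : WTerm S κ ι P) :
    tval A f c legs χ D (oact o t) = o.a * tval A f c legs χ (D ++ o.D) t := by
  simp only [tval, oact, List.append_assoc, mul_assoc]

omit [LinearOrder κ] [Fintype P] in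
/-- Blocks are invisible to values. [cite: BalabanImbrieJaffe1988, §5.14 p.311] -/
theorem tval_addConst (D : List (S → ℝ)) (g : WGrp S κ ι P) (t : WTerm S κ ι P) :
    tval A f c legs χ D (t.addConst g) = tval A f c legs χ D t := rfl

/-- **THE COMPONENT EXPANSION WITH THE COVARIANCE SPLIT LOSES NOTHING**: for complete components `done` set aside,
untouched observables `rest` and `χ′`-directions `D` already present,
`∫ Π_{legsOf done rest}Φ · (Π_D∂)χ · e^{−V} dμ = Σ_{t ∈ expand done rest} tval D t`, given `Σ_p Cov p = A⁻¹`.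
[cite: BalabanImbrieJaffe1988, §5.14 p.311–312] -/
theorem expand_val (hA : A.PosDef) (hχ : ∀ D : List (S → ℝ), ContDiff ℝ 1 (dlist D χ))
    (h0 : ∀ D : List (S → ℝ), ∃ K, ∀ φ, ‖dlist D χ φ * vexp c legs φ‖ ≤ K) (hCov : ∑ p, Cov p = A⁻¹) :
    ∀ (n : ℕ) (done : Multiset (WGrp S κ ι P)) (rest : Finset κ), rest.card < n →
      (∀ h ∈ done, h.complete M = true) → ∀ D : List (S → ℝ),
        gintM A f c legs χ (legsOf obs done rest) D
          = ((expand Cov trig f c legs obs M done rest).map (tval A f c legs χ D)).sum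
  | 0, _, _, hn => fun _ _ => absurd hn (Nat.not_lt_zero _)
  | n + 1, done, rest, hn => by
    intro hd D
    by_cases h : rest.Nonempty
    · rw [expand_of_nonempty Cov trig f c legs obs M h, sum_map_mbind, legsOf_erase obs done (rest.min'_mem h)]
      have e0 : (obs (rest.min' h) : Multiset (S → ℝ))
          = ((pristine (ι := ι) (P := P) obs (rest.min' h)).pend : Multiset (S → ℝ)) := rfl
      rw [e0, run_val hA hχ h0 hCov _ _ _ _ (Nat.lt_succ_self _) D]
      rw [← Multiset.attach_map_val'
        (run Cov trig f c legs obs M (pristine obs (rest.min' h)) (rest.erase (rest.min' h)) done)]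
      refine congrArg _ (Multiset.map_congr rfl fun o _ => ?_)
      have ho := o.2
      have hcard : o.1.rest.card < n := lt_of_lt_of_le (lt_of_le_of_lt (Finset.card_le_card
        (run_rest_subset _ _ _ _ ho)) (Finset.card_erase_lt_of_mem (rest.min'_mem h))) (Nat.lt_succ_iff.1 hn)
      have hdo : ∀ h ∈ o.1.done, h.complete M = true :=
        fun h hh => hd h (Multiset.mem_of_le (run_done_le _ _ _ _ ho) hh)
      split_ifs with hg
      · -- a constant component: no pending leg; booked as a block
        have hp0 : (o.1.g.pend : Multiset (S → ℝ)) = 0 := by rw [hg.1]; rfl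
        rw [oval, hp0, zero_add, expand_val hA hχ h0 hCov n _ _ hcard hdo (D ++ o.1.D), Multiset.map_map,
          ← Multiset.sum_map_mul_left]
        refine congrArg _ (Multiset.map_congr rfl fun t _ => ?_)
        rw [Function.comp_apply, tval_addConst, tval_act]
      · -- a remainder component: set aside
        have hdo' : ∀ h ∈ o.1.g ::ₘ o.1.done, h.complete M = true := fun h hh => by
          rcases Multiset.mem_cons.1 hh with rfl | hh
          · exact run_complete _ _ _ _ ho
          · exact hdo h hh
        rw [oval, ← legsOf_cons, expand_val hA hχ h0 hCov n _ _ hcard hdo' (D ++ o.1.D), Multiset.map_map,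
          ← Multiset.sum_map_mul_left]
        refine congrArg _ (Multiset.map_congr rfl fun t _ => ?_)
        rw [Function.comp_apply, tval_act]
    · rw [expand_of_not_nonempty Cov trig f c legs obs M h, Finset.not_nonempty_iff_eq_empty.1 h]
      simp [tval, legsOf]

/-- **THE INTEGRATION BY PARTS OF A PRODUCT OF OBSERVABLES WITH THE COVARIANCE SPLIT** (p. 311–312): for observables
`K` with leg lists `obs`, in the Gaussian measure `dμ_{C,ℱ}` with weight `χe^{−V}`, and pieces `Σ_p Cov p = C = A⁻¹`:
`∫ Π_{i∈K} Π_{w ∈ obs i}Φ(w) · χe^{−V} dμ = Σ_{t ∈ expand 0 K} coef_t ∫ Π_{legs of t's remainder components}Φ · (Π_{dirs_t}∂)χ · e^{−V} dμ`,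
every block a constant component, every set-aside component complete (`expand_sound`), and — under the linking
hypotheses — every block and remainder component of a contributing term `R`-connected
(`BIJ88WalkExpansionGeo311.expand_geo_init`).
[cite: BalabanImbrieJaffe1988, §5.14 p.311–312] -/
theorem expand_val_init (hA : A.PosDef) (hχ : ∀ D : List (S → ℝ), ContDiff ℝ 1 (dlist D χ))
    (h0 : ∀ D : List (S → ℝ), ∃ K, ∀ φ, ‖dlist D χ φ * vexp c legs φ‖ ≤ K) (hCov : ∑ p, Cov p = A⁻¹) (K : Finset κ) :
    gintM A f c legs χ ((K.val.map fun j => (obs j : Multiset (S → ℝ))).sum) []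
      = ((expand Cov trig f c legs obs M 0 K).map (tval A f c legs χ [])).sum := by
  have h := expand_val (A := A) (Cov := Cov) (trig := trig) (f := f) (c := c) (legs := legs) (χ := χ) (obs := obs)
    (M := M) hA hχ h0 hCov _ 0 K (Nat.lt_succ_self _) (fun _ hh => absurd hh (Multiset.notMem_zero _)) []
  simpa [legsOf] using h

end Literature.MathematicalPhysics.QuantumFieldTheory.BalabanImbrieJaffe1984to88.BIJ88WalkIdentity311

end
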